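import Literature.Probability.Percolation.MarkedLoopNecessitySevenBasis
import HarnessLib

/-!
# Seven disorders: the rotated Khristoforov–Smirnov fans do NOT exhaust the discretely holomorphic observables («FAN-SEVEN-DEFICIT»)

Topic `Literature/Probability/Percolation`; a short rider on `MarkedLoopNecessitySevenBasis.lean` (★★★
`forall_holomorphicW_iff_exists_sum_basisW_seven`: the seven-disorder class weights that are discretely holomorphic on every seven-marked
domain are exactly SOLVED-SEVEN's fourteen-parameter family) and on `MarkedLoopTripodBasisSeven.lean` § SevenFans (`fanR₇`,
`finrank_span_fanR₇ = 7`, `span_fanR₇_ne_top`).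

THE CONTRAST WITH FIVE DISORDERS. At `k = 5` the tree's `MarkedLoopFanFivePoint.lean` shows that every five-disorder class weight holomorphic on
every five-marked domain restricts, on the patterns, to a combination of the five rotated fans (`forall_holomorphicW_iff_exists_sum_fanR`). At
`k = 7` this FAILS: the holomorphic observables form a fourteen-dimensional family of pattern weights (`solW 7`), the seven rotated fans span only a
seven-dimensional subspace of it, so there are discretely holomorphic seven-disorder class-weight observables that are not combinations of rotated
fans (`exists_forall_holomorphicW_not_mem_span_fanR₇`). Nothing here is in print beyond Khristoforov–Smirnov's three-disorder observable; the
objects (`HolomorphicW`, `fanWt`, `rotW`, `solW`, `basisW`) are the lane's generic-`k` formalisation of their §2.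

## References
* M. Khristoforov, S. Smirnov, *Percolation and O(1) loop model*, arXiv:2111.15612 (2021), §2 Definition 3, Lemma 4 and Remark 6 (arXiv v1 pp. 4–5).
-/

namespace Literature.Probability.Percolation.MarkedLoops

open Literature.Probability.Percolation Literature.Probability.LatticeModels
open TriMarkedDomain

/-- ★★ **holomorphic on every seven-marked domain ⟺ the pattern restriction is a tripod-law solution** (`solW 7`, dimension fourteen).
[cite: KhristoforovSmirnov2021, §2 Definition 3 and Lemma 4 (arXiv v1 p. 4)] -/
theorem forall_holomorphicW_iff_restrictW_mem_solW_seven (wt : Fin 7 → Finset (Fin 7 × Fin 7) → ℂ) :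
    (∀ D : TriMarkedDomain 7, HolomorphicW D wt) ↔ restrictW wt ∈ solW 7 := by
  rw [← tripodLaw_iff_forall_holomorphicW_seven, tripodLaw_iff_restrict_mem_solW]

/-- ★★ **the pattern weights realised by the everywhere-holomorphic seven-disorder class weights are exactly `solW 7`.**
[cite: KhristoforovSmirnov2021, §2 Definition 3 and Lemma 4 (arXiv v1 p. 4)] -/
theorem setOf_restrictW_forall_holomorphicW_seven :
    {w : Pat 7 → ℂ | ∃ wt : Fin 7 → Finset (Fin 7 × Fin 7) → ℂ, (∀ D : TriMarkedDomain 7, HolomorphicW D wt) ∧ restrictW wt = w} =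
      (solW 7 : Set (Pat 7 → ℂ)) := by
  ext w
  simp only [Set.mem_setOf_eq, SetLike.mem_coe]
  constructor
  · rintro ⟨wt, hwt, rfl⟩
    exact (forall_holomorphicW_iff_restrictW_mem_solW_seven wt).1 hwt
  · intro hw
    exact ⟨classWt w, fun D => holomorphicW_classWt D hw, restrictW_classWt w⟩

/-- the span of the seven rotated fans, read inside `Pat 7 → ℂ`, is the image of their span inside `solW 7`.
[cite: KhristoforovSmirnov2021, §2 Remark 6 (arXiv v1 p. 5)] -/
theorem span_range_fanR₇_eq_map :
    Submodule.span ℂ (Set.range fanR₇) =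
      (Submodule.span ℂ (Set.range fun s : Fin 7 => (⟨fanR₇ s, fanR₇_mem_solW s⟩ : solW 7))).map (solW 7).subtype := by
  rw [Submodule.map_span, ← Set.range_comp]
  rfl

/-- ★★ **the fan span has dimension seven inside the fourteen-dimensional family** (read in `Pat 7 → ℂ`).
[cite: KhristoforovSmirnov2021, §2 Remark 6 (arXiv v1 p. 5)] -/
theorem finrank_span_range_fanR₇ : Module.finrank ℂ (Submodule.span ℂ (Set.range fanR₇)) = 7 := by
  rw [finrank_span_eq_card, Fintype.card_fin]
  have h := linearIndependent_fanR₇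
  have : (fun s : Fin 7 => fanR₇ s) = (solW 7).subtype ∘ fun s : Fin 7 => (⟨fanR₇ s, fanR₇_mem_solW s⟩ : solW 7) := rfl
  rw [show fanR₇ = (solW 7).subtype ∘ fun s : Fin 7 => (⟨fanR₇ s, fanR₇_mem_solW s⟩ : solW 7) from this]
  exact h.map' _ (Submodule.ker_subtype _)

/-- ★★★ **AT SEVEN DISORDERS THE ROTATED FANS DO NOT EXHAUST THE DISCRETELY HOLOMORPHIC OBSERVABLES**: there is a seven-disorder class weight,
discretely holomorphic on every seven-marked domain, whose restriction to the patterns is NOT a linear combination of the seven rotated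
Khristoforov–Smirnov fans (contrast: at five disorders every such weight is a fan combination, `MarkedLoopFanFivePoint.lean`).
[cite: KhristoforovSmirnov2021, §2 Definition 3, Lemma 4 and Remark 6 (arXiv v1 pp. 4–5)] -/
theorem exists_forall_holomorphicW_not_mem_span_fanR₇ :
    ∃ wt : Fin 7 → Finset (Fin 7 × Fin 7) → ℂ, (∀ D : TriMarkedDomain 7, HolomorphicW D wt) ∧
      restrictW wt ∉ Submodule.span ℂ (Set.range fanR₇) := by
  by_contra hne
  push Not at hne
  apply span_fanR₇_ne_top
  rw [eq_top_iff]
  rintro w -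
  have hw : w.1 ∈ Submodule.span ℂ (Set.range fanR₇) := by
    have := hne (classWt w.1) (fun D => holomorphicW_classWt D w.2)
    rwa [restrictW_classWt] at this
  rw [span_range_fanR₇_eq_map, Submodule.mem_map] at hw
  obtain ⟨y, hy, hyw⟩ := hw
  have : y = w := Subtype.ext hyw
  exact this ▸ hy

/-- ★★ … equivalently: **not every tripod-law solution at seven marks is a combination of rotated fans** (the solution-space form).
[cite: KhristoforovSmirnov2021, §2 Remark 6 (arXiv v1 p. 5)] -/
theorem exists_mem_solW_seven_not_mem_span_fanR₇ : ∃ w ∈ solW 7, w ∉ Submodule.span ℂ (Set.range fanR₇) := by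
  obtain ⟨wt, hwt, hn⟩ := exists_forall_holomorphicW_not_mem_span_fanR₇
  exact ⟨restrictW wt, (forall_holomorphicW_iff_restrictW_mem_solW_seven wt).1 hwt, hn⟩

end Literature.Probability.Percolation.MarkedLoops
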